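import Summits.AtomisticToContinuum.Crystallization.Theorems.FrustratedLawDichotomyCappedRigidityCert

/-!
# FrustratedLawDichotomy · crux `AperiodicFrustratedLawGap` (stmt-AtomisticToContinuum-27623) — THE ℚ-MIRROR OF `M`, PATTERN SIDE:
# the fcc / hcp contact graphs separate points, hence `CappedCert θ η fcc ∧ CappedCert θ η hcp ⟹ CappedRigidity θ η (= M)`,
# and the by-name corollaries `G ∧ P ∧ Cert_fcc ∧ Cert_hcp ⟹ KR2Shape ⟹ …` (decomp-a2c, prover hand 2, gen 9)

Companion of `FrustratedLawDichotomyCappedRigidityCert` (the reduction `cappedRigidityAt_of_cert` for a general pattern `Pat` under the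
hypothesis that its contact graph separates points).  Here:

* `dist_scaledPattern`, `dist_eq_one_iff_sqNormInt`, `dist_eq_sqrt_two_iff_sqNormInt` — distances in a scaled integer pattern
  `{v/√N}` are read off `sqNormInt (v − w)` (contact ⟺ `= N`, square diagonal ⟺ `= 2N`); the integer interface a certificate replays.
* `fccInt_contactSeparating`, `hcpInt_contactSeparating` (by `decide`) and their transport `fcc_contactSeparating`,
  `hcp_contactSeparating`: for `u ≠ v` in the pattern some `w` touches `u` but not `v`.
* `cappedRigidity_of_cert : CappedCert θ η fccKissingPattern → CappedCert θ η hcpKissingPattern → CappedRigidity θ η` (every `θ, η`).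
* by name through the lens-5 cut (p820342): `kr2Shape_of_certs`, `aperiodicFrustratedLawGap_of_certs` (crux, given `MuEquilibriumDoor`
  and `ChargedEnergyGap`), `noFrustratedPeriodicMinimiser_of_certs` (item 26654, door-free).
So the dichotomy column reads `FDG ⟸ 14231 ∧ G(1/100) ∧ P(1/100) ∧ CappedCert(1/100, 1/20, fcc) ∧ CappedCert(1/100, 1/20, hcp)` with the
two `CappedCert`s FINITE statements (census KR18-C's constraint set).  `[folklore]` bookkeeping; no definitions, no `sorry`.
-/

noncomputable section

namespace Summit.AtomisticToContinuum.Crystallization.Theorems.FrustratedLawDichotomyCappedRigidityCertPatterns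

open Literature.Geometry.DiscreteGeometry
open Summit.AtomisticToContinuum.Crystallization.Theses.PricedLinkCensus (ChargedEnergyGap)
open Summit.AtomisticToContinuum.Crystallization.Theorems.FrustratedLawDichotomyTwoShellRigidityCut
  (E3 LinkClassification CapForcing CappedRigidity KR2Shape kr2Shape_of_cut aperiodicFrustratedLawGap_of_cut
    noFrustratedPeriodicMinimiser_of_cut)
open Summit.AtomisticToContinuum.Crystallization.Theorems.FrustratedLawDichotomyCappedRigidityCert
  (CappedCert cappedRigidityAt_of_cert)

/-! ### Distances in a scaled integer pattern -/

/-- In the scaled pattern `{v/√N}` the distance of the images of `v, w` is `√(sqNormInt (v − w) / N)`. [folklore] -/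
theorem dist_scaledPattern {N : ℕ} (hN : N ≠ 0) (v w : Fin 3 → ℤ) :
    dist ((Real.sqrt N)⁻¹ • intVec v : E3) ((Real.sqrt N)⁻¹ • intVec w) = Real.sqrt ((sqNormInt (v - w) : ℝ) / N) := by
  have hpos : (0 : ℝ) < Real.sqrt N := by positivity
  rw [dist_eq_norm, ← smul_sub, intVec_sub, norm_smul, norm_inv, Real.norm_of_nonneg hpos.le, norm_intVec,
    Real.sqrt_div' _ (Nat.cast_nonneg N), div_eq_mul_inv, mul_comm]

/-- Contact in the scaled pattern ⟺ `sqNormInt (v − w) = N`. [folklore] -/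
theorem dist_eq_one_iff_sqNormInt {N : ℕ} (hN : N ≠ 0) (v w : Fin 3 → ℤ) :
    dist ((Real.sqrt N)⁻¹ • intVec v : E3) ((Real.sqrt N)⁻¹ • intVec w) = 1 ↔ sqNormInt (v - w) = N := by
  have hN' : (N : ℝ) ≠ 0 := by exact_mod_cast hN
  rw [dist_scaledPattern hN, Real.sqrt_eq_one, div_eq_one_iff_eq hN']
  constructor
  · intro h
    exact_mod_cast h
  · intro h
    rw [h]
    push_cast
    rfl

/-- Square diagonal in the scaled pattern ⟺ `sqNormInt (v − w) = 2N`. [folklore] -/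
theorem dist_eq_sqrt_two_iff_sqNormInt {N : ℕ} (hN : N ≠ 0) (v w : Fin 3 → ℤ) :
    dist ((Real.sqrt N)⁻¹ • intVec v : E3) ((Real.sqrt N)⁻¹ • intVec w) = Real.sqrt 2 ↔ sqNormInt (v - w) = 2 * N := by
  have hN' : (N : ℝ) ≠ 0 := by exact_mod_cast hN
  have h0 : (0 : ℝ) ≤ (sqNormInt (v - w) : ℝ) / N := by
    apply div_nonneg _ (Nat.cast_nonneg N)
    have : (0 : ℤ) ≤ sqNormInt (v - w) := by unfold sqNormInt; positivity
    exact_mod_cast this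
  rw [dist_scaledPattern hN]
  constructor
  · intro h
    have h2 : (sqNormInt (v - w) : ℝ) / N = 2 := by
      have := congrArg (fun x : ℝ => x ^ 2) h
      simpa only [Real.sq_sqrt h0, Real.sq_sqrt (by norm_num : (0 : ℝ) ≤ 2)] using this
    rw [div_eq_iff hN'] at h2
    exact_mod_cast h2
  · intro h
    rw [h]
    push_cast
    rw [mul_div_assoc, div_self hN', mul_one]

/-- **Point separation by contacts** transported from the integer model to the scaled pattern. [folklore] -/
theorem contactSeparating_scaledPattern {S : Finset (Fin 3 → ℤ)} {N : ℕ} (hN : N ≠ 0)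
    (h : ∀ v ∈ S, ∀ w ∈ S, v ≠ w → ∃ z ∈ S, sqNormInt (v - z) = N ∧ sqNormInt (w - z) ≠ N) :
    ∀ u u' : ↥(scaledPattern S N), u ≠ u' →
      ∃ w : ↥(scaledPattern S N), dist (u : E3) (w : E3) = 1 ∧ dist (u' : E3) (w : E3) ≠ 1 := by
  intro u u' hne
  have hu := u.2
  have hu' := u'.2
  simp only [scaledPattern, Finset.mem_image] at hu hu'
  obtain ⟨v, hv, hvu⟩ := hu
  obtain ⟨v', hv', hvu'⟩ := hu'
  have hvv' : v ≠ v' := fun hv_eq => hne (Subtype.ext (by rw [← hvu, ← hvu', hv_eq]))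
  obtain ⟨z, hz, h1, h2⟩ := h v hv v' hv' hvv'
  have hzmem : ((Real.sqrt N)⁻¹ • intVec z : E3) ∈ scaledPattern S N := by
    simp only [scaledPattern, Finset.mem_image]
    exact ⟨z, hz, rfl⟩
  refine ⟨⟨_, hzmem⟩, ?_, ?_⟩
  · show dist (u : E3) ((Real.sqrt N)⁻¹ • intVec z) = 1
    rw [← hvu]
    exact (dist_eq_one_iff_sqNormInt hN v z).2 h1
  · show dist (u' : E3) ((Real.sqrt N)⁻¹ • intVec z) ≠ 1
    rw [← hvu']
    exact fun h' => h2 ((dist_eq_one_iff_sqNormInt hN v' z).1 h')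

/-! ### The two kissing patterns -/

set_option maxRecDepth 4000 in
/-- In the integer cuboctahedron, for `v ≠ w` some `z` is in contact with `v` but not with `w`. [folklore] -/
theorem fccInt_contactSeparating :
    ∀ v ∈ fccInt, ∀ w ∈ fccInt, v ≠ w → ∃ z ∈ fccInt, sqNormInt (v - z) = 2 ∧ sqNormInt (w - z) ≠ 2 := by
  decide

set_option maxRecDepth 4000 in
/-- In the integer anticuboctahedron, for `v ≠ w` some `z` is in contact with `v` but not with `w`. [folklore] -/
theorem hcpInt_contactSeparating :
    ∀ v ∈ hcpInt, ∀ w ∈ hcpInt, v ≠ w → ∃ z ∈ hcpInt, sqNormInt (v - z) = 18 ∧ sqNormInt (w - z) ≠ 18 := by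
  decide

/-- **The fcc contact graph separates points.** [folklore] -/
theorem fcc_contactSeparating :
    ∀ u u' : ↥fccKissingPattern, u ≠ u' →
      ∃ w : ↥fccKissingPattern, dist (u : E3) (w : E3) = 1 ∧ dist (u' : E3) (w : E3) ≠ 1 :=
  contactSeparating_scaledPattern two_ne_zero fccInt_contactSeparating

/-- **The hcp contact graph separates points.** [folklore] -/
theorem hcp_contactSeparating :
    ∀ u u' : ↥hcpKissingPattern, u ≠ u' →
      ∃ w : ↥hcpKissingPattern, dist (u : E3) (w : E3) = 1 ∧ dist (u' : E3) (w : E3) ≠ 1 :=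
  contactSeparating_scaledPattern (by norm_num) hcpInt_contactSeparating

/-! ### `M` from the two finite certificates, and the column by name -/

/-- **`CappedCert θ η fcc ∧ CappedCert θ η hcp ⟹ CappedRigidity θ η` (= lens-5's `M`)**, every `θ, η`. [folklore] -/
theorem cappedRigidity_of_cert {θ η : ℝ} (hf : CappedCert θ η fccKissingPattern) (hh : CappedCert θ η hcpKissingPattern) :
    CappedRigidity θ η :=
  ⟨cappedRigidityAt_of_cert fcc_contactSeparating hf, cappedRigidityAt_of_cert hcp_contactSeparating hh⟩

/-- **`G(1/100) ∧ P(1/100) ∧ CappedCert(1/100, 1/20, fcc) ∧ CappedCert(1/100, 1/20, hcp) ⟹ KR2Shape`** (= `h2` of the two-shell door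
p817755). [folklore] -/
theorem kr2Shape_of_certs (hG : LinkClassification (1 / 100)) (hP : CapForcing (1 / 100))
    (hf : CappedCert (1 / 100) (1 / 20) fccKissingPattern) (hh : CappedCert (1 / 100) (1 / 20) hcpKissingPattern) : KR2Shape :=
  kr2Shape_of_cut hG hP (cappedRigidity_of_cert hf hh)

/-- **`AperiodicFrustratedLawGap` (crux of item 27623) BY NAME from `MuEquilibriumDoor ∧ ChargedEnergyGap ∧ G ∧ P ∧ Cert_fcc ∧ Cert_hcp`.**
[folklore] -/
theorem aperiodicFrustratedLawGap_of_certs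
    (hDoor : Summit.AtomisticToContinuum.Crystallization.Theses.GrainCoreNetworkSplit.MuEquilibriumDoor) (hgap : ChargedEnergyGap)
    (hG : LinkClassification (1 / 100)) (hP : CapForcing (1 / 100))
    (hf : CappedCert (1 / 100) (1 / 20) fccKissingPattern) (hh : CappedCert (1 / 100) (1 / 20) hcpKissingPattern) :
    Summit.AtomisticToContinuum.Crystallization.Theses.FrustratedLawDichotomy.AperiodicFrustratedLawGap :=
  aperiodicFrustratedLawGap_of_cut hDoor hgap hG hP (cappedRigidity_of_cert hf hh)

/-- **`NoFrustratedPeriodicMinimiser` (item 26654), DOOR-FREE, from `ChargedEnergyGap ∧ G ∧ P ∧ Cert_fcc ∧ Cert_hcp`.** [folklore] -/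
theorem noFrustratedPeriodicMinimiser_of_certs (hgap : ChargedEnergyGap)
    (hG : LinkClassification (1 / 100)) (hP : CapForcing (1 / 100))
    (hf : CappedCert (1 / 100) (1 / 20) fccKissingPattern) (hh : CappedCert (1 / 100) (1 / 20) hcpKissingPattern) :
    Summit.AtomisticToContinuum.Crystallization.Theses.PeriodicChargeSplit.NoFrustratedPeriodicMinimiser :=
  noFrustratedPeriodicMinimiser_of_cut hgap hG hP (cappedRigidity_of_cert hf hh)

end Summit.AtomisticToContinuum.Crystallization.Theorems.FrustratedLawDichotomyCappedRigidityCertPatterns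

end
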